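import Summits.BirchSwinnertonDyer.Rank1Residual.X11b.ChaPairsMinimality
import HarnessLib

/-!
# Global minimality of a literal integer equation: two more Kraus patterns at `2` and a FACTORED
# form of the criterion (cell `b2b-bsdres`, supersingular family prover B = unit
# `b2b-bsdres-additive-p3`, gen 20; TOOL file for the per-pair record campaigns)

HONEST FRAMING (run/shared/lean/b2b/bsd-rank1-residual/, verbatim in every file): the goal of the
cell is to DELETE the COMBINATION-SHAPED residual classes of the Birch–Swinnerton-Dyer formula for
ALL analytic-rank `≤ 1` elliptic curves over `ℚ` — "full BSD formula for every rank `≤ 1` curve in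
class `C`" assembled STRICTLY from published theorems — so that the rank-`≤ 1` remainder becomes
exactly the CONSTRUCTION-SHAPED classes, which are TYPED (missing-input `Prop`s), NOT attempted.
This is not "finishing BSD". Nothing here is about BSD: three elementary statements about the
minimality of an integral Weierstrass equation, extending x11c's
`Rank1ResidualX11KrausMinimality.lean` / `isGloballyMinimal_of_krausCriterion(_bounded)` (Silverman's
`q¹² ∤ Δ ∨ q⁴ ∤ c₄` at every prime, or the Kraus patterns F2a `2⁸ ∤ c₄ ∧ 2⁷ ∣ c₆`, F2b
`2²⁴ ∤ Δ ∧ c₆ = 2⁹L, L ≡ 3 (4)`, F3 `3⁸ ‖ c₆`) and `X11b/ChaPairsMinimality.lean` (F2c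
`2²⁴ ∤ Δ ∧ c₆ = 2¹⁰M, M odd`). THEOREMS ONLY (no definition, no named fact).

WHY: of the 1 257 rank-one supersingular cells OPEN at engine-A ROUND 203 (class-closure O3/O4),
79 Cremona models fail the bounded criterion at `q = 2` although they are minimal — 76 of them with
`ord₂ c₄ = 4`, `ord₂ c₆ = 6`, `c₆/2⁶ ≡ 1 (mod 4)` and 3 with `ord₂ c₄ ≥ 8`, `ord₂ c₆ = 10`,
`ord₂ Δ = 14` — and 8 have `|Δ| ≥ 512¹²` (the bounded form's size guard). Hence:

* §1 `isMinimalAt_two_of_c₆_eq_64_mul` (pattern F2d) — `2⁸ ∤ c₄`, `c₆ = 64·L`, `L ≡ 1 (mod 4)` ⟹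
  minimal at `2`: the only candidate descent `u = 2w` has `c₆' = c₆/(64w⁶) = L·w⁻⁶`, a unit
  `≡ 1 (mod 4)` (`w⁻⁶ ≡ 1 (mod 8)`), so Kraus's alternatives `32 ∣ c₆'`, `c₆' ≡ 8 (32)`,
  `c₆' ≡ −1 (4)` all fail (`isMinimal_of_kraus_fails`). The second pattern needed (F2c: `2²⁴ ∤ Δ`,
  `c₆ = 1024·M`, `M` odd) is x11c gen 3's `X11b.isMinimalAt_two_of_c₆_eq_1024_mul`
  (`X11b/ChaPairsMinimality.lean`), reused.
* §2 `isGloballyMinimal_of_krausCriterion₃` (x11c's `…₂` of `ChaPairsMinimality.lean` — Silverman,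
  F2a, F2c, F3 — with F2b and F2d added: all five Kraus patterns), its bounded `decide` form
  `…₃_bounded`, and the FACTORED form `…₃_factored`: the complete prime factorisation
  `|Δ| = ∏ qᵢ^{eᵢ}` (primality and the product kernel-checked) replaces the size guard `|Δ| < 512¹²`,
  the per-prime disjunction being asked only at the `qᵢ`.

References: A. Kraus, Acta Arith. 54 (1989) 75–80, Prop. 2 [Kraus1989]; J. E. Cremona, *Algorithms
for Modular Elliptic Curves* (1997) §3.2 [CremonaAlgorithms1997]; J. H. Silverman, *AEC* (2009)
III.1 Table 3.1, VII.1 Remark 1.1, VIII.8 [SilvermanAEC2009].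
-/

set_option autoImplicit false

noncomputable section

open scoped Classical

open IsDedekindDomain NumberField Rat.HeightOneSpectrum WeierstrassCurve
  Literature.NumberTheory.EllipticCurves Literature.NumberTheory.GaloisRepresentations
  Literature.NumberTheory.EllipticCurves.Rank1Residual.X11RankOneCertificates
  Summit.BirchSwinnertonDyer.BirchSwinnertonDyer.Rank1Residual.X11RankOne

namespace Summit.BirchSwinnertonDyer.Rank1Residual.Supersingular

/-! ### §1. One more Kraus pattern at the place of `2` (F2d) -/

section Two

variable (v : HeightOneSpectrum (𝓞 ℚ)) (W : WeierstrassCurve ℚ)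

/-- **Minimality at `2`, pattern `2⁸ ∤ c₄`, `c₆ = 2⁶L`, `L ≡ 1 (mod 4)`.** For `W / ℚ` integral at the
place `v` of `2` with `|c₄|₂ > 2⁻⁸`, `c₆(W) = 64·L`, `4 ∣ L − 1`: `W` is minimal at `v`. The only
candidate descent is `u = 2w` (`w` a unit); the descended `c₆' = c₆/(64w⁶) = y := L·w⁻⁶` is a unit
with `|y − 1| ≤ 2⁻²` (`w⁻⁶ ≡ 1 (mod 8)`), so `|y| = 1`, `|y − 8| = 1`, `|y + 1| = 2⁻¹`, and every
alternative of Kraus's condition at `2` fails (`isMinimal_of_kraus_fails`). Covers 76 Cremona models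
of the cell's O3/O4 rank-one census (`ord₂ c₄ = 4`, `ord₂ c₆ = 6`). [cite: Kraus1989, Prop. 2]
[cite: CremonaAlgorithms1997, §3.2 (Laska–Kraus–Connell)] -/
theorem isMinimalAt_two_of_c₆_eq_64_mul (hv : natGenerator v = 2) (hint : W.IsIntegralAt v)
    (hc4 : WithZero.exp (-8 : ℤ) < v.valuation ℚ W.c₄) {L : ℤ} (hL : W.c₆ = 64 * L)
    (hL1 : (4 : ℤ) ∣ L - 1) : W.IsMinimalAt v := by
  set K := v.adicCompletion ℚ with hK
  set Y : WeierstrassCurve K := W.baseChange K with hY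
  haveI : Y.IsIntegral (v.adicCompletionIntegers ℚ) := hint
  have V2 := valued_two v hv
  have h20 : (2 : K) ≠ 0 := by
    intro h; rw [h, Valuation.map_zero] at V2; exact WithZero.coe_ne_zero V2.symm
  have V8 : Valued.v (8 : K) = WithZero.exp (-3 : ℤ) := by
    rw [show (8 : K) = 2 ^ 3 by norm_num, Valuation.map_pow, V2, ← WithZero.exp_nsmul]; norm_num
  have hYc4 : WithZero.exp (-8 : ℤ) < Valued.v Y.c₄ := by
    rw [hY, WeierstrassCurve.baseChange, map_c₄, WeierstrassCurve.valued_algebraMap_adicCompletion]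
    exact hc4
  have hYc6 : Y.c₆ = 64 * algebraMap ℚ K L := by
    rw [hY, WeierstrassCurve.baseChange, map_c₆, hL, map_mul]; norm_num
  have hLodd : ¬ (2 : ℤ) ∣ L := fun h ↦ by
    have h4 : (2 : ℤ) ∣ L - 1 := dvd_trans ⟨2, by norm_num⟩ hL1
    have : (2 : ℤ) ∣ 1 := by simpa using dvd_sub h h4
    norm_num at this
  set l : K := algebraMap ℚ K L with hl
  have hVl : Valued.v l = 1 := valued_intCast_eq_one_of_odd v hv hLodd
  have hVl1 : Valued.v (l - 1) ≤ WithZero.exp (-2 : ℤ) := by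
    have := valued_intCast_le_of_dvd v hv (n := L - 1) (e := 2) (by simpa using hL1)
    rwa [Int.cast_sub, map_sub, Int.cast_one, map_one] at this
  refine isMinimal_of_kraus_fails v hv Y hYc4 fun w hw H ↦ ?_
  have hw0 : w ≠ 0 := by
    intro h; rw [h, Valuation.map_zero] at hw; exact zero_ne_one hw
  have hwi : Valued.v w⁻¹ = 1 := by rw [map_inv₀, hw, inv_one]
  set y : K := w⁻¹ ^ 6 * l with hy
  have hunit : Valued.v y = 1 := by
    rw [hy, Valuation.map_mul, Valuation.map_pow, hwi, one_pow, one_mul, hVl]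
  have h64 : (64 : K) ≠ 0 := by
    rw [show (64 : K) = 2 ^ 6 by norm_num]; exact pow_ne_zero _ h20
  have he : Y.c₆ / (64 * w ^ 6) = y := by
    rw [hYc6, hy, div_eq_iff (mul_ne_zero h64 (pow_ne_zero 6 hw0)), inv_pow,
      show ((w ^ 6)⁻¹ * l) * (64 * w ^ 6) = 64 * l * ((w ^ 6)⁻¹ * w ^ 6) by ring,
      inv_mul_cancel₀ (pow_ne_zero 6 hw0), mul_one]
  rw [he] at H
  rcases H with ⟨-, h | h⟩ | h
  · rw [hunit, ← WithZero.exp_zero, WithZero.exp_le_exp] at h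
    norm_num at h
  · have hlt : Valued.v (8 : K) < Valued.v y := by
      rw [V8, hunit, ← WithZero.exp_zero, WithZero.exp_lt_exp]; norm_num
    have : Valued.v (y - 8) = 1 := by
      rw [Valuation.map_sub_eq_of_lt_left _ hlt, hunit]
    rw [this, ← WithZero.exp_zero, WithZero.exp_le_exp] at h
    norm_num at h
  · -- `y + 1 = ((w⁻⁶ - 1)L + (L - 1)) + 2` has valuation `exp(-1)`
    have h6 := valued_pow_six_sub_one_le v hv hwi
    have hsmall : Valued.v ((w⁻¹ ^ 6 - 1) * l + (l - 1)) ≤ WithZero.exp (-2 : ℤ) := by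
      refine Valuation.map_add_le _ ?_ hVl1
      rw [Valuation.map_mul, hVl, mul_one]
      exact h6.trans (by rw [WithZero.exp_le_exp]; norm_num)
    have hlt2 : Valued.v ((w⁻¹ ^ 6 - 1) * l + (l - 1)) < Valued.v (2 : K) := by
      rw [V2]; exact lt_of_le_of_lt hsmall (by rw [WithZero.exp_lt_exp]; norm_num)
    have hy1 : Valued.v (y + 1) = WithZero.exp (-1 : ℤ) := by
      have : y + 1 = ((w⁻¹ ^ 6 - 1) * l + (l - 1)) + 2 := by rw [hy]; ring
      rw [this, Valuation.map_add_eq_of_lt_right _ hlt2, V2]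
    rw [hy1, WithZero.exp_le_exp] at h
    norm_num at h

end Two

/-! ### §2. The extended global criterion: unbounded, bounded, factored -/

/-- **x11c's global-minimality criterion with ALL FIVE Kraus patterns** (`q = 2`: F2a `2⁸ ∤ c₄ ∧ 2⁷ ∣ c₆`;
F2b `2²⁴ ∤ Δ ∧ c₆ = 512L, L ≡ 3 (4)`; F2d `2⁸ ∤ c₄ ∧ c₆ = 64L, L ≡ 1 (4)`; F2c `2²⁴ ∤ Δ ∧ c₆ = 1024L, L odd`;
`q = 3`: F3 `3⁸ ‖ c₆`). [cite: SilvermanAEC2009, VII.1 Remark 1.1 and VIII.8]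
[cite: Kraus1989, Prop. 1 and Prop. 2] -/
theorem isGloballyMinimal_of_krausCriterion₃ (a1 a2 a3 a4 a6 : ℤ)
    (h : ∀ q : ℕ, q.Prime →
      (¬ (q : ℤ) ^ 12 ∣ discOf [a1, a2, a3, a4, a6] ∨ ¬ (q : ℤ) ^ 4 ∣ c4Of [a1, a2, a3, a4, a6]) ∨
      (q = 2 ∧ ¬ (2 : ℤ) ^ 8 ∣ c4Of [a1, a2, a3, a4, a6] ∧ (2 : ℤ) ^ 7 ∣ c6Of [a1, a2, a3, a4, a6]) ∨
      (q = 2 ∧ ¬ (2 : ℤ) ^ 24 ∣ discOf [a1, a2, a3, a4, a6] ∧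
        ∃ L : ℤ, c6Of [a1, a2, a3, a4, a6] = 512 * L ∧ (4 : ℤ) ∣ L - 3) ∨
      (q = 2 ∧ ¬ (2 : ℤ) ^ 8 ∣ c4Of [a1, a2, a3, a4, a6] ∧
        ∃ L : ℤ, c6Of [a1, a2, a3, a4, a6] = 64 * L ∧ (4 : ℤ) ∣ L - 1) ∨
      (q = 2 ∧ ¬ (2 : ℤ) ^ 24 ∣ discOf [a1, a2, a3, a4, a6] ∧
        ∃ L : ℤ, c6Of [a1, a2, a3, a4, a6] = 1024 * L ∧ ¬ (2 : ℤ) ∣ L) ∨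
      (q = 3 ∧ (3 : ℤ) ^ 8 ∣ c6Of [a1, a2, a3, a4, a6] ∧ ¬ (3 : ℤ) ^ 9 ∣ c6Of [a1, a2, a3, a4, a6])) :
    (⟨a1, a2, a3, a4, a6⟩ : WeierstrassCurve ℚ).IsGloballyMinimal where
  isIntegral := isIntegral_of_exists_lift (𝓞 ℚ) ⟨(a1 : 𝓞 ℚ), by simp⟩ ⟨(a2 : 𝓞 ℚ), by simp⟩
    ⟨(a3 : 𝓞 ℚ), by simp⟩ ⟨(a4 : 𝓞 ℚ), by simp⟩ ⟨(a6 : 𝓞 ℚ), by simp⟩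
  isMinimal v := by
    set W : WeierstrassCurve ℚ := ⟨a1, a2, a3, a4, a6⟩ with hW
    have hle : ∀ m : ℤ, v.valuation ℚ (m : ℚ) ≤ 1 := fun m ↦ by
      have hm : (m : ℚ) = algebraMap (𝓞 ℚ) ℚ (m : 𝓞 ℚ) := by simp
      rw [hm]
      exact v.valuation_le_one _
    have hint : W.IsIntegralAt v :=
      W.isIntegralAt_of_valuation_le_one v (hle a1) (hle a2) (hle a3) (hle a4) (hle a6)
    have hΔ : W.Δ = ((discOf [a1, a2, a3, a4, a6] : ℤ) : ℚ) := by
      simp only [hW, WeierstrassCurve.Δ, WeierstrassCurve.b₂, WeierstrassCurve.b₄, WeierstrassCurve.b₆,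
        WeierstrassCurve.b₈, discOf, invariants]
      push_cast
      ring
    have hc4 : W.c₄ = ((c4Of [a1, a2, a3, a4, a6] : ℤ) : ℚ) := by
      simp only [hW, WeierstrassCurve.c₄, WeierstrassCurve.b₂, WeierstrassCurve.b₄, c4Of, invariants]
      push_cast
      ring
    have hc6 : W.c₆ = ((c6Of [a1, a2, a3, a4, a6] : ℤ) : ℚ) := by
      simp only [hW, WeierstrassCurve.c₆, WeierstrassCurve.b₂, WeierstrassCurve.b₄, WeierstrassCurve.b₆,
        c6Of, invariants]
      push_cast
      ring
    haveI hYint : (W.baseChange (v.adicCompletion ℚ)).IsIntegral (v.adicCompletionIntegers ℚ) := hint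
    have hYc4 : Valued.v (W.baseChange (v.adicCompletion ℚ)).c₄ = v.valuation ℚ W.c₄ := by
      rw [WeierstrassCurve.baseChange, map_c₄, WeierstrassCurve.valued_algebraMap_adicCompletion]
    have hYc6 : Valued.v (W.baseChange (v.adicCompletion ℚ)).c₆ = v.valuation ℚ W.c₆ := by
      rw [WeierstrassCurve.baseChange, map_c₆, WeierstrassCurve.valued_algebraMap_adicCompletion]
    rcases h _ (prime_natGenerator v) with (h12 | h4) | ⟨h2, h8, h7⟩ | ⟨h2, h24, L, hL, hL3⟩ |
        ⟨h2, h8, L, hL, hL1⟩ | ⟨h2, h24, L, hL, hLo⟩ | ⟨h3, h8, h9⟩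
    · exact isMinimalAt_of_lt_valuation_Δ_holds hint
        (by rw [hΔ]; exact exp_neg_lt_valuation_intCast_of_not_pow_dvd v h12)
    · exact isMinimalAt_of_lt_valuation_c₄ hint
        (by rw [hc4]; exact exp_neg_lt_valuation_intCast_of_not_pow_dvd v h4)
    · refine isMinimal_two_of_valued_c₄_c₆ v h2 _ ?_ ?_
      · rw [hYc4, hc4]
        exact exp_neg_lt_valuation_intCast_of_not_pow_dvd v (by rw [h2]; exact_mod_cast h8)
      · rw [hYc6, hc6]
        exact_mod_cast Rat.valuation_intCast_le v (e := 7) (by rw [h2]; exact_mod_cast h7)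
    · refine isMinimalAt_two_of_c₆_eq_512_mul v W h2 hint ?_ (L := L) (by rw [hc6, hL]; push_cast; ring)
        hL3
      rw [hΔ]
      exact_mod_cast exp_neg_lt_valuation_intCast_of_not_pow_dvd v (e := 24) (by rw [h2]; exact_mod_cast h24)
    · refine isMinimalAt_two_of_c₆_eq_64_mul v W h2 hint ?_ (L := L) (by rw [hc6, hL]; push_cast; ring)
        hL1
      rw [hc4]
      exact_mod_cast exp_neg_lt_valuation_intCast_of_not_pow_dvd v (e := 8) (by rw [h2]; exact_mod_cast h8)
    · refine Summit.BirchSwinnertonDyer.Rank1Residual.X11b.isMinimalAt_two_of_c₆_eq_1024_mul v W h2 hint ?_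
        (M := L) (by rw [hc6, hL]; push_cast; ring) hLo
      rw [hΔ]
      exact_mod_cast exp_neg_lt_valuation_intCast_of_not_pow_dvd v (e := 24) (by rw [h2]; exact_mod_cast h24)
    · refine isMinimal_three_of_valued_c₆ v h3 _ ?_ ?_
      · rw [hYc6, hc6]
        exact_mod_cast Rat.valuation_intCast_le v (e := 8) (by rw [h3]; exact_mod_cast h8)
      · rw [hYc6, hc6]
        exact_mod_cast exp_neg_lt_valuation_intCast_of_not_pow_dvd v (e := 9)
          (by rw [h3]; exact_mod_cast h9)

/-- **Bounded form of the extended criterion** (the shape `decide` evaluates): `Δ ≠ 0`, `|Δ| < 512¹²`,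
and for every `q < 512` Silverman's disjuncts or one of the FIVE Kraus patterns.
[cite: SilvermanAEC2009, VII.1 Remark 1.1] [cite: Kraus1989, Prop. 1 and Prop. 2] -/
theorem isGloballyMinimal_of_krausCriterion₃_bounded (a1 a2 a3 a4 a6 : ℤ)
    (h0 : discOf [a1, a2, a3, a4, a6] ≠ 0) (hB : (discOf [a1, a2, a3, a4, a6]).natAbs < 512 ^ 12)
    (h : ∀ q < 512, q < 2 ∨ ¬ q ^ 12 ∣ (discOf [a1, a2, a3, a4, a6]).natAbs ∨
      ¬ q ^ 4 ∣ (c4Of [a1, a2, a3, a4, a6]).natAbs ∨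
      (q = 2 ∧ ¬ (2 : ℤ) ^ 8 ∣ c4Of [a1, a2, a3, a4, a6] ∧ (2 : ℤ) ^ 7 ∣ c6Of [a1, a2, a3, a4, a6]) ∨
      (q = 2 ∧ ¬ (2 : ℤ) ^ 24 ∣ discOf [a1, a2, a3, a4, a6] ∧ (512 : ℤ) ∣ c6Of [a1, a2, a3, a4, a6] ∧
        (4 : ℤ) ∣ c6Of [a1, a2, a3, a4, a6] / 512 - 3) ∨
      (q = 2 ∧ ¬ (2 : ℤ) ^ 8 ∣ c4Of [a1, a2, a3, a4, a6] ∧ (64 : ℤ) ∣ c6Of [a1, a2, a3, a4, a6] ∧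
        (4 : ℤ) ∣ c6Of [a1, a2, a3, a4, a6] / 64 - 1) ∨
      (q = 2 ∧ ¬ (2 : ℤ) ^ 24 ∣ discOf [a1, a2, a3, a4, a6] ∧ (1024 : ℤ) ∣ c6Of [a1, a2, a3, a4, a6] ∧
        ¬ (2 : ℤ) ∣ c6Of [a1, a2, a3, a4, a6] / 1024) ∨
      (q = 3 ∧ (3 : ℤ) ^ 8 ∣ c6Of [a1, a2, a3, a4, a6] ∧ ¬ (3 : ℤ) ^ 9 ∣ c6Of [a1, a2, a3, a4, a6])) :
    (⟨a1, a2, a3, a4, a6⟩ : WeierstrassCurve ℚ).IsGloballyMinimal := by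
  refine isGloballyMinimal_of_krausCriterion₃ a1 a2 a3 a4 a6 fun q hq ↦ ?_
  have hpos : 0 < (discOf [a1, a2, a3, a4, a6]).natAbs := Int.natAbs_pos.mpr h0
  by_cases hqB : q < 512
  · rcases h q hqB with hlt | h12 | h4 | hF2a | ⟨h2, h24, h512, h43⟩ | ⟨h2, h8, h64, h41⟩ |
        ⟨h2, h24, h1024, hodd⟩ | hF3
    · exact absurd hq.two_le (by omega)
    · refine Or.inl (Or.inl fun h12' ↦ h12 ?_)
      rw [← Int.natCast_dvd]; exact_mod_cast h12'
    · refine Or.inl (Or.inr fun h4' ↦ h4 ?_)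
      rw [← Int.natCast_dvd]; exact_mod_cast h4'
    · exact Or.inr (Or.inl hF2a)
    · refine Or.inr (Or.inr (Or.inl ⟨h2, h24, c6Of [a1, a2, a3, a4, a6] / 512, ?_, h43⟩))
      exact (Int.mul_ediv_cancel' h512).symm
    · refine Or.inr (Or.inr (Or.inr (Or.inl ⟨h2, h8, c6Of [a1, a2, a3, a4, a6] / 64, ?_, h41⟩)))
      exact (Int.mul_ediv_cancel' h64).symm
    · refine Or.inr (Or.inr (Or.inr (Or.inr (Or.inl ⟨h2, h24, c6Of [a1, a2, a3, a4, a6] / 1024, ?_, hodd⟩))))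
      exact (Int.mul_ediv_cancel' h1024).symm
    · exact Or.inr (Or.inr (Or.inr (Or.inr (Or.inr hF3))))
  · refine Or.inl (Or.inl fun h12 ↦ ?_)
    have h12' : q ^ 12 ∣ (discOf [a1, a2, a3, a4, a6]).natAbs := by
      rw [← Int.natCast_dvd]; exact_mod_cast h12
    have hle : q ^ 12 ≤ (discOf [a1, a2, a3, a4, a6]).natAbs := Nat.le_of_dvd hpos h12'
    have hge : 512 ^ 12 ≤ q ^ 12 := Nat.pow_le_pow_left (by omega) 12
    omega

/-- **Factored form of the extended criterion** (no size guard): the COMPLETE prime factorisation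
`|Δ| = ∏ (q, e) ∈ F, q ^ e` with every `q` prime (both kernel-checkable), and the per-prime disjunction
asked only at the primes of `F`; any other prime `q` has `q ∤ Δ`, hence `q¹² ∤ Δ`.
[cite: SilvermanAEC2009, VII.1 Remark 1.1 and VIII.8] [cite: Kraus1989, Prop. 1 and Prop. 2] -/
theorem isGloballyMinimal_of_krausCriterion₃_factored (a1 a2 a3 a4 a6 : ℤ) (F : List (ℕ × ℕ))
    (hF : (discOf [a1, a2, a3, a4, a6]).natAbs = (F.map fun qe => qe.1 ^ qe.2).prod)
    (hpr : ∀ qe ∈ F, qe.1.Prime)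
    (h : ∀ qe ∈ F, ¬ qe.1 ^ 12 ∣ (discOf [a1, a2, a3, a4, a6]).natAbs ∨
      ¬ qe.1 ^ 4 ∣ (c4Of [a1, a2, a3, a4, a6]).natAbs ∨
      (qe.1 = 2 ∧ ¬ (2 : ℤ) ^ 8 ∣ c4Of [a1, a2, a3, a4, a6] ∧ (2 : ℤ) ^ 7 ∣ c6Of [a1, a2, a3, a4, a6]) ∨
      (qe.1 = 2 ∧ ¬ (2 : ℤ) ^ 24 ∣ discOf [a1, a2, a3, a4, a6] ∧ (512 : ℤ) ∣ c6Of [a1, a2, a3, a4, a6] ∧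
        (4 : ℤ) ∣ c6Of [a1, a2, a3, a4, a6] / 512 - 3) ∨
      (qe.1 = 2 ∧ ¬ (2 : ℤ) ^ 8 ∣ c4Of [a1, a2, a3, a4, a6] ∧ (64 : ℤ) ∣ c6Of [a1, a2, a3, a4, a6] ∧
        (4 : ℤ) ∣ c6Of [a1, a2, a3, a4, a6] / 64 - 1) ∨
      (qe.1 = 2 ∧ ¬ (2 : ℤ) ^ 24 ∣ discOf [a1, a2, a3, a4, a6] ∧ (1024 : ℤ) ∣ c6Of [a1, a2, a3, a4, a6] ∧
        ¬ (2 : ℤ) ∣ c6Of [a1, a2, a3, a4, a6] / 1024) ∨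
      (qe.1 = 3 ∧ (3 : ℤ) ^ 8 ∣ c6Of [a1, a2, a3, a4, a6] ∧ ¬ (3 : ℤ) ^ 9 ∣ c6Of [a1, a2, a3, a4, a6])) :
    (⟨a1, a2, a3, a4, a6⟩ : WeierstrassCurve ℚ).IsGloballyMinimal := by
  refine isGloballyMinimal_of_krausCriterion₃ a1 a2 a3 a4 a6 fun q hq ↦ ?_
  by_cases hqΔ : q ∣ (discOf [a1, a2, a3, a4, a6]).natAbs
  · -- `q` is one of the listed primes
    rw [hF] at hqΔ
    obtain ⟨x, hx, hqx⟩ := ((Nat.prime_iff.mp hq).dvd_prod_iff).mp hqΔ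
    obtain ⟨qe, hqe, rfl⟩ := List.mem_map.mp hx
    have hqq : q = qe.1 := by
      have hd : q ∣ qe.1 := hq.dvd_of_dvd_pow hqx
      exact (Nat.prime_dvd_prime_iff_eq hq (hpr qe hqe)).mp hd
    subst hqq
    rcases h qe hqe with h12 | h4 | hF2a | ⟨h2, h24, h512, h43⟩ | ⟨h2, h8, h64, h41⟩ |
        ⟨h2, h24, h1024, hodd⟩ | hF3
    · refine Or.inl (Or.inl fun h12' ↦ h12 ?_)
      rw [← Int.natCast_dvd]; exact_mod_cast h12'
    · refine Or.inl (Or.inr fun h4' ↦ h4 ?_)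
      rw [← Int.natCast_dvd]; exact_mod_cast h4'
    · exact Or.inr (Or.inl hF2a)
    · refine Or.inr (Or.inr (Or.inl ⟨h2, h24, c6Of [a1, a2, a3, a4, a6] / 512, ?_, h43⟩))
      exact (Int.mul_ediv_cancel' h512).symm
    · refine Or.inr (Or.inr (Or.inr (Or.inl ⟨h2, h8, c6Of [a1, a2, a3, a4, a6] / 64, ?_, h41⟩)))
      exact (Int.mul_ediv_cancel' h64).symm
    · refine Or.inr (Or.inr (Or.inr (Or.inr (Or.inl ⟨h2, h24, c6Of [a1, a2, a3, a4, a6] / 1024, ?_, hodd⟩))))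
      exact (Int.mul_ediv_cancel' h1024).symm
    · exact Or.inr (Or.inr (Or.inr (Or.inr (Or.inr hF3))))
  · refine Or.inl (Or.inl fun h12 ↦ hqΔ ?_)
    have h12' : q ^ 12 ∣ (discOf [a1, a2, a3, a4, a6]).natAbs := by
      rw [← Int.natCast_dvd]; exact_mod_cast h12
    exact dvd_trans (dvd_pow_self q (by norm_num)) h12'

end Summit.BirchSwinnertonDyer.Rank1Residual.Supersingular

end
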